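import Summits.Ventures.LatticeQCDFlow.Scaling.HubAcceptanceLaw
import Summits.Ventures.LatticeQCDFlow.Scaling.ProductRefreshCeiling
import Summits.Ventures.LatticeQCDFlow.Scaling.DominatedStarAugmentation

/-!
HONEST FRAMING: exact (Metropolis-corrected) sampling algorithms for lattice gauge theory; figures
of merit are autocorrelation/cost numbers at stated couplings and volumes; no continuum-physics
claim.

# MapStarRotation — THE ROTATION-PATH VARIANCE INEQUALITY THROUGH PER-ENTRY MAPS: FOR A HUB LIST `r ↦ (0, κ_r+1)`
# WHOSE ENTRY `r` CARRIES ITS OWN BIJECTION `φ_r`, UNDER TRANSPORTED ONE-SIDED DOMINATION `p·ν_{κ_r+1}(φ_r u) ≤ ν_0(u)`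
# AND MULTIPLICITY `≥ c` OF EVERY COLD LEVEL,
# `Var_{ν⊗}(f) ≤ (1/2 + 3K/p)·V₀(f) + (3/(2pc))·Σ_r T_r(f)` — `V₀` THE HOT-REDRAW ENERGY, `T_r` THE ENTRY-SWAP ENERGY
# `Σ_z min{ν⊗(z), ν⊗(y_r z)}(f z − f(y_r z))²`; NO CHAIN, NO REGIME, NO COMMON CHANGE OF COORDINATES (lean-2 GEN-28, ours)

Venture-side (OURS).  Cell `lqcd-flow` (pub-lqcd), unit `pub-lqcd-lean-2-g28`, 2026-08-28.  Chapter N (the regime-free quadratic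
theory of the map-assisted hot-refreshed hub of chapter M), file 1.  Chapter M (`Scaling/DominatedStar*`) bounds the DISTANCE PROFILE
of the scheme `t·GSw + (1−t)·Π_w^M` with ENTRY maps `φ : Fin m → Equiv.Perm S` only in the regime `4t ≤ p(1−t)w_0`; chapter K
(`Scaling/FlowHubProposalLaw`) has the regime-free variational gap but only for LEVEL maps `φ_k` (one bijection per cold level, by the
level-coordinate conjugacy — "NOT CLAIMED: maps that differ between entries at the same cold level").  This file runs the rotation
paths of `Scaling/StarConveyorRotation` (J1) DIRECTLY THROUGH THE MAP OF EACH ENTRY: for the target move `z ↦ z^{l←v}` at the cold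
level `l = κ_r+1` of entry `r`, relabel the hub to `φ_r⁻¹v`, swap through `φ_r` (the hub receives `φ_r⁻¹(z_l)`, level `l` receives
`φ_r(φ_r⁻¹ v) = v`), relabel the hub back to `z_0`.  Every edge is weighted by the cold law of the content it moves, which the hot law
dominates after transport; no reverse domination, no conjugacy, and entries at the same level may carry different maps.  The output is
a CHAIN-FREE inequality between the variance under the product law and two energies; the next file reads both energies off the
Dirichlet form of the chapter-M scheme.

## What is proved

* §1 `update_eq_mapRotation` (the path ends at the target), `mapRotation_mid_eq`, `update_update_zero_eq` (the two endpoints of the back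
  leg); the three legs for one hub edge `(0,l)` with map `ψ` under `p·ν_l(ψ u) ≤ ν_0(u)`: **`mapStar_leg_relabel_le`** (`≤ p⁻¹·V₀`),
  **`mapStar_leg_swap_le`** (`≤ p⁻¹·T`, `T = Σ_z min{ν⊗(z), ν⊗(y z)}(f z − f(y z))²`, `y = edgeFlowSwap ψ 0 l`), **`mapStar_leg_back_le`**
  (`≤ p⁻¹·V₀`), where `V₀ = Σ_zΣ_v ν⊗(z)ν_0(v)(f z − f z^{0←v})²`; **`mapStar_coldRedraw_le`** — the cold-redraw energy at level `l`,
  `Σ_zΣ_v ν⊗(z)ν_l(v)(f z − f z^{l←v})² ≤ (6/p)·V₀ + (3/p)·T`.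
* §2 **`mapStar_coldRedraw_le_fiber`** (average over the `c_k ≥ c` entries of a level), **`mapStar_variance_le`** — hub list `κ`,
  entry maps `φ`, transported one-sided domination `p·ν_{κ_r+1}(φ_r u) ≤ ν_0(u)`, every cold level listed `≥ c ≥ 1` times:
  **`Var_{ν⊗}(f) ≤ (1/2 + 3K/p)·V₀(f) + (3/(2pc))·Σ_r T_r(f)`** (Efron–Stein over the `K+1` coordinates, the hub coordinate kept, each
  cold coordinate routed through its own entries).

Reading (no numerics implied): the per-entry maps cost nothing in the quadratic theory — the relabel budget carries one power of `K` (all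
cold levels share the hub's redraws), the swap budget none beyond the multiplicity.  NOT CLAIMED: anything about a distance profile or a
mixing time (chapter M's regime question for `d(n)` is untouched here); sharp constants; continuous spaces; anything measured.
Literature grade (cell rule): KNOWN MECHANISM (comparison/rotation paths, Diaconis–Saloff-Coste 1993; J1 in the tree), NEW TYPING
(per-entry transports); nothing cited as a fact; no new bib keys.
-/

noncomputable section

open Finset Function
open Literature.Probability.MarkovChains

namespace Summit.Ventures.LatticeQCDFlow.Scaling

variable {S : Type*} [Fintype S] {K : ℕ} {ν : Fin (K + 1) → S → ℝ}

/-! ## §1 The rotation path through the map of one hub edge -/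

omit [Fintype S] in
/-- **The rotation path through `ψ` on the hub edge `(0,l)` ends at the target:**
`z^{l←v} = (y(z^{0←ψ⁻¹v}))^{0←z_0}` with `y = edgeFlowSwap ψ 0 l`. [ours] -/
theorem update_eq_mapRotation (z : Fin (K + 1) → S) {l : Fin (K + 1)} (hl : l ≠ 0) (ψ : Equiv.Perm S) (v : S) :
    update z l v = update (edgeFlowSwap ψ 0 l (update z 0 (ψ.symm v))) 0 (z 0) := by
  funext i
  by_cases h0 : i = 0
  · rw [h0, update_self, update_of_ne (Ne.symm hl)]
  · rw [update_of_ne h0]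
    by_cases h1 : i = l
    · rw [h1, update_self, edgeFlowSwap_snd, update_self, Equiv.apply_symm_apply]
    · rw [update_of_ne h1, edgeFlowSwap_of_ne ψ 0 l _ h0 h1, update_of_ne h0]

omit [Fintype S] in
/-- The middle vertex of the path: `y(z^{0←ψ⁻¹v}) = (z^{l←v})^{0←ψ⁻¹(z_l)}`. [ours] -/
theorem mapRotation_mid_eq (z : Fin (K + 1) → S) {l : Fin (K + 1)} (hl : l ≠ 0) (ψ : Equiv.Perm S) (v : S) :
    edgeFlowSwap ψ 0 l (update z 0 (ψ.symm v)) = update (update z l v) 0 (ψ.symm (z l)) := by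
  funext i
  by_cases h1 : i = l
  · rw [h1, edgeFlowSwap_snd, update_self, Equiv.apply_symm_apply, update_of_ne hl, update_self]
  · by_cases h0 : i = 0
    · rw [h0, edgeFlowSwap_fst ψ (Ne.symm hl), update_of_ne hl, update_self]
    · rw [edgeFlowSwap_of_ne ψ 0 l _ h0 h1, update_of_ne h0, update_of_ne h0, update_of_ne h1]

omit [Fintype S] in
/-- Resetting the hub after a detour: `((z^{l←v})^{0←u})^{0←z_0} = z^{l←v}` (`l ≠ 0`). [ours] -/
theorem update_update_zero_eq (z : Fin (K + 1) → S) {l : Fin (K + 1)} (hl : l ≠ 0) (v u : S) :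
    update (update (update z l v) 0 u) 0 (z 0) = update z l v := by
  funext i
  by_cases h0 : i = 0
  · rw [h0, update_self, update_of_ne (Ne.symm hl)]
  · rw [update_of_ne h0, update_of_ne h0]

section Legs

variable (hν : ∀ k u, 0 < ν k u) (hν1 : ∀ k, ∑ u, ν k u = 1) {p : ℝ} (hp : 0 < p)
  {l : Fin (K + 1)} (hl : l ≠ 0) {ψ : Equiv.Perm S} (hpers : ∀ u : S, p * ν l (ψ u) ≤ ν 0 u)
include hν hp hpers

omit [Fintype S] hν in
/-- Transported one-sided domination as a ratio: `ν_l(ψ u) ≤ p⁻¹·ν_0(u)`. [ours] -/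
theorem transported_le_inv_mul_hot (u : S) : ν l (ψ u) ≤ 1 / p * ν 0 u := by
  rw [one_div, inv_mul_eq_div, le_div_iff₀ hp, mul_comm]; exact hpers u

/-- **THE FIRST LEG (relabel the hub to the pulled-back fresh content):**
`Σ_zΣ_v ν⊗(z)ν_l(v)(f z − f z^{0←ψ⁻¹v})² ≤ p⁻¹·V₀`. [ours] -/
theorem mapStar_leg_relabel_le (f : (Fin (K + 1) → S) → ℝ) :
    ∑ z : Fin (K + 1) → S, ∑ v, tensorFun ν z * ν l v * (f z - f (update z 0 (ψ.symm v))) ^ 2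
      ≤ 1 / p * ∑ z : Fin (K + 1) → S, ∑ v, tensorFun ν z * ν 0 v * (f z - f (update z 0 v)) ^ 2 := by
  rw [mul_sum]; refine sum_le_sum fun z _ => ?_
  have e : ∑ v, tensorFun ν z * ν l v * (f z - f (update z 0 (ψ.symm v))) ^ 2
      = ∑ u, tensorFun ν z * ν l (ψ u) * (f z - f (update z 0 u)) ^ 2 := by
    have h := (Equiv.sum_comp ψ (fun v => tensorFun ν z * ν l v * (f z - f (update z 0 (ψ.symm v))) ^ 2)).symm
    simpa only [Equiv.symm_apply_apply] using h
  rw [e, mul_sum]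
  refine sum_le_sum fun u _ => ?_
  have hz : 0 ≤ tensorFun ν z := (tensorFun_pos hν z).le
  calc tensorFun ν z * ν l (ψ u) * (f z - f (update z 0 u)) ^ 2
      ≤ tensorFun ν z * (1 / p * ν 0 u) * (f z - f (update z 0 u)) ^ 2 :=
        mul_le_mul_of_nonneg_right (mul_le_mul_of_nonneg_left (transported_le_inv_mul_hot hp hpers u) hz) (sq_nonneg _)
    _ = _ := by ring

include hν1 hl in
/-- **THE SWAP LEG (swap the relabelled hub into level `l` through `ψ`):**
`Σ_zΣ_v ν⊗(z)ν_l(v)(f z^{0←ψ⁻¹v} − f(y z^{0←ψ⁻¹v}))² ≤ p⁻¹·Σ_w min{ν⊗(w), ν⊗(y w)}(f w − f(y w))²`, `y = edgeFlowSwap ψ 0 l`: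
after summing out `z_0` the edge `w → y w` carries the weight `ν_l(ψ w_0)·Π_{j≠0}ν_j(w_j)`, which transported domination bounds by
`p⁻¹·min{ν⊗(w), ν⊗(y w)}` at BOTH ends (`p·ν_l(ψ w_0) ≤ ν_0(w_0)` and `p·ν_l(w_l) ≤ ν_0(ψ⁻¹ w_l)`). [ours] -/
theorem mapStar_leg_swap_le (f : (Fin (K + 1) → S) → ℝ) :
    ∑ z : Fin (K + 1) → S, ∑ v, tensorFun ν z * ν l v
        * (f (update z 0 (ψ.symm v)) - f (edgeFlowSwap ψ 0 l (update z 0 (ψ.symm v)))) ^ 2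
      ≤ 1 / p * ∑ w : Fin (K + 1) → S, min (tensorFun ν w) (tensorFun ν (edgeFlowSwap ψ 0 l w))
          * (f w - f (edgeFlowSwap ψ 0 l w)) ^ 2 := by
  set G : (Fin (K + 1) → S) → ℝ := fun w => (f w - f (edgeFlowSwap ψ 0 l w)) ^ 2 with hG
  have hG0 : ∀ w, 0 ≤ G w := fun w => sq_nonneg _
  -- reindex `v = ψ u`
  have e1 : ∀ z : Fin (K + 1) → S, ∑ v, tensorFun ν z * ν l v * G (update z 0 (ψ.symm v))
      = ∑ u, tensorFun ν z * ν l (ψ u) * G (update z 0 u) := by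
    intro z
    have h := (Equiv.sum_comp ψ (fun v => tensorFun ν z * ν l v * G (update z 0 (ψ.symm v)))).symm
    simpa only [Equiv.symm_apply_apply] using h
  -- the update involution at the hub: `(z, u) ↦ (z^{0←u}, z_0)`
  have e2 : ∑ z : Fin (K + 1) → S, ∑ u, tensorFun ν z * ν l (ψ u) * G (update z 0 u)
      = ∑ z : Fin (K + 1) → S, ∑ s, tensorFun ν (update z 0 s) * ν l (ψ (z 0)) * G z := by
    have h := sum_update_involution (0 : Fin (K + 1)) (fun z s => tensorFun ν (update z 0 s) * ν l (ψ (z 0)) * G z)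
    simp only [update_idem, update_eq_self, update_self] at h
    exact h
  -- sum out the hub content
  have e3 : ∀ z : Fin (K + 1) → S, ∑ s, tensorFun ν (update z 0 s) * ν l (ψ (z 0)) * G z
      = (∏ i ∈ univ \ {0}, ν i (z i)) * ν l (ψ (z 0)) * G z := by
    intro z
    rw [← sum_mul, ← sum_mul]
    congr 1; congr 1
    simp_rw [tensorFun_update ν z 0]
    rw [← sum_mul, hν1 0, one_mul]
  -- the weight of the swap edge is dominated at both ends
  have key : ∀ z : Fin (K + 1) → S, p * ((∏ i ∈ univ \ {0}, ν i (z i)) * ν l (ψ (z 0)))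
      ≤ min (tensorFun ν z) (tensorFun ν (edgeFlowSwap ψ 0 l z)) := by
    intro z
    set R := ∏ i ∈ univ \ {0}, ν i (z i) with hR
    have hR0 : 0 ≤ R := prod_nonneg fun i _ => (hν _ _).le
    have hz : tensorFun ν z = ν 0 (z 0) * R := tensorFun_eq_mul_prod ν z 0
    refine le_min ?_ ?_
    · rw [hz]
      calc p * (R * ν l (ψ (z 0))) = (p * ν l (ψ (z 0))) * R := by ring
        _ ≤ ν 0 (z 0) * R := mul_le_mul_of_nonneg_right (hpers (z 0)) hR0
    · have hc : 0 < ν 0 (z 0) * ν l (z l) := mul_pos (hν _ _) (hν _ _)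
      have hsw := tensorFun_edgeFlowSwap_mul ν ψ (Ne.symm hl) z
      have hq : p * ν l (z l) ≤ ν 0 (ψ.symm (z l)) := by
        have h := hpers (ψ.symm (z l)); rwa [Equiv.apply_symm_apply] at h
      refine le_of_mul_le_mul_right ?_ hc
      rw [hsw, hz]
      have hw : 0 ≤ R * ν l (ψ (z 0)) * ν 0 (z 0) := mul_nonneg (mul_nonneg hR0 (hν _ _).le) (hν _ _).le
      calc p * (R * ν l (ψ (z 0))) * (ν 0 (z 0) * ν l (z l))
          = (p * ν l (z l)) * (R * ν l (ψ (z 0)) * ν 0 (z 0)) := by ring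
        _ ≤ ν 0 (ψ.symm (z l)) * (R * ν l (ψ (z 0)) * ν 0 (z 0)) := mul_le_mul_of_nonneg_right hq hw
        _ = ν 0 (z 0) * R * (ν 0 (ψ.symm (z l)) * ν l (ψ (z 0))) := by ring
  calc ∑ z : Fin (K + 1) → S, ∑ v, tensorFun ν z * ν l v * G (update z 0 (ψ.symm v))
      = ∑ z : Fin (K + 1) → S, (∏ i ∈ univ \ {0}, ν i (z i)) * ν l (ψ (z 0)) * G z := by
        rw [sum_congr rfl fun z _ => e1 z, e2]; exact sum_congr rfl fun z _ => e3 z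
    _ ≤ ∑ z : Fin (K + 1) → S, 1 / p * (min (tensorFun ν z) (tensorFun ν (edgeFlowSwap ψ 0 l z)) * G z) := by
        refine sum_le_sum fun z _ => ?_
        calc (∏ i ∈ univ \ {0}, ν i (z i)) * ν l (ψ (z 0)) * G z
            = 1 / p * (p * ((∏ i ∈ univ \ {0}, ν i (z i)) * ν l (ψ (z 0)))) * G z := by field_simp
          _ ≤ 1 / p * min (tensorFun ν z) (tensorFun ν (edgeFlowSwap ψ 0 l z)) * G z :=
              mul_le_mul_of_nonneg_right (mul_le_mul_of_nonneg_left (key z) (by positivity)) (hG0 z)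
          _ = _ := by ring
    _ = 1 / p * ∑ z : Fin (K + 1) → S, min (tensorFun ν z) (tensorFun ν (edgeFlowSwap ψ 0 l z)) * G z := by
        rw [mul_sum]

include hl in
/-- **THE BACK LEG (relabel the hub back to its old content):**
`Σ_zΣ_v ν⊗(z)ν_l(v)(f(y z^{0←ψ⁻¹v}) − f((y z^{0←ψ⁻¹v})^{0←z_0}))² ≤ p⁻¹·V₀` — the update involution at level `l`, then the
reindexing `s = ψ u` and transported domination once. [ours] -/
theorem mapStar_leg_back_le (f : (Fin (K + 1) → S) → ℝ) :
    ∑ z : Fin (K + 1) → S, ∑ v, tensorFun ν z * ν l v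
        * (f (edgeFlowSwap ψ 0 l (update z 0 (ψ.symm v)))
            - f (update (edgeFlowSwap ψ 0 l (update z 0 (ψ.symm v))) 0 (z 0))) ^ 2
      ≤ 1 / p * ∑ z : Fin (K + 1) → S, ∑ v, tensorFun ν z * ν 0 v * (f z - f (update z 0 v)) ^ 2 := by
  -- the two endpoints of the back leg
  have e0 : ∀ (z : Fin (K + 1) → S) (v : S), tensorFun ν z * ν l v
        * (f (edgeFlowSwap ψ 0 l (update z 0 (ψ.symm v)))
            - f (update (edgeFlowSwap ψ 0 l (update z 0 (ψ.symm v))) 0 (z 0))) ^ 2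
      = tensorFun ν z * ν l v * (f (update (update z l v) 0 (ψ.symm (z l))) - f (update z l v)) ^ 2 := by
    intro z v
    rw [mapRotation_mid_eq z hl ψ v, update_update_zero_eq z hl v (ψ.symm (z l))]
  -- the update involution at level `l`: `(z, v) ↦ (z^{l←v}, z_l)`
  have e1 : ∑ z : Fin (K + 1) → S, ∑ v, tensorFun ν z * ν l v
        * (f (update (update z l v) 0 (ψ.symm (z l))) - f (update z l v)) ^ 2
      = ∑ z : Fin (K + 1) → S, ∑ s, tensorFun ν (update z l s) * ν l (z l) * (f (update z 0 (ψ.symm s)) - f z) ^ 2 := by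
    have h := sum_update_involution l
      (fun z s => tensorFun ν (update z l s) * ν l (z l) * (f (update z 0 (ψ.symm s)) - f z) ^ 2)
    simp only [update_idem, update_eq_self, update_self] at h
    exact h
  -- the swapped weight and the reindexing `s = ψ u`
  have e2 : ∀ z : Fin (K + 1) → S, ∑ s, tensorFun ν (update z l s) * ν l (z l) * (f (update z 0 (ψ.symm s)) - f z) ^ 2
      = ∑ u, tensorFun ν z * ν l (ψ u) * (f z - f (update z 0 u)) ^ 2 := by
    intro z
    have h := (Equiv.sum_comp ψ
      (fun s => tensorFun ν (update z l s) * ν l (z l) * (f (update z 0 (ψ.symm s)) - f z) ^ 2)).symm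
    simp only [Equiv.symm_apply_apply] at h
    rw [h]
    refine sum_congr rfl fun u _ => ?_
    rw [tensorFun_update_mul ν z l (ψ u)]
    ring
  rw [sum_congr rfl fun z _ => sum_congr rfl fun v _ => e0 z v, e1, sum_congr rfl fun z _ => e2 z, mul_sum]
  refine sum_le_sum fun z _ => ?_
  rw [mul_sum]
  refine sum_le_sum fun u _ => ?_
  have hz : 0 ≤ tensorFun ν z := (tensorFun_pos hν z).le
  calc tensorFun ν z * ν l (ψ u) * (f z - f (update z 0 u)) ^ 2
      ≤ tensorFun ν z * (1 / p * ν 0 u) * (f z - f (update z 0 u)) ^ 2 :=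
        mul_le_mul_of_nonneg_right (mul_le_mul_of_nonneg_left (transported_le_inv_mul_hot hp hpers u) hz) (sq_nonneg _)
    _ = _ := by ring

include hν1 hl in
/-- **THE COLD-REDRAW ENERGY AT LEVEL `l` THROUGH ONE ENTRY:**
`Σ_zΣ_v ν⊗(z)ν_l(v)(f z − f z^{l←v})² ≤ (6/p)·V₀ + (3/p)·Σ_w min{ν⊗(w), ν⊗(y w)}(f w − f(y w))²`. [ours] -/
theorem mapStar_coldRedraw_le (f : (Fin (K + 1) → S) → ℝ) :
    ∑ z : Fin (K + 1) → S, ∑ v, tensorFun ν z * ν l v * (f z - f (update z l v)) ^ 2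
      ≤ 6 / p * ∑ z : Fin (K + 1) → S, ∑ v, tensorFun ν z * ν 0 v * (f z - f (update z 0 v)) ^ 2
        + 3 / p * ∑ w : Fin (K + 1) → S, min (tensorFun ν w) (tensorFun ν (edgeFlowSwap ψ 0 l w))
            * (f w - f (edgeFlowSwap ψ 0 l w)) ^ 2 := by
  have hW0 : ∀ z, 0 ≤ tensorFun ν z := fun z => (tensorFun_pos hν z).le
  have L1 := mapStar_leg_relabel_le hν hp hpers f
  have L2 := mapStar_leg_swap_le hν hν1 hp hl hpers f
  have L3 := mapStar_leg_back_le hν hp hl hpers f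
  have hpt : ∀ (z : Fin (K + 1) → S) (v : S), tensorFun ν z * ν l v * (f z - f (update z l v)) ^ 2
      ≤ 3 * (tensorFun ν z * ν l v * (f z - f (update z 0 (ψ.symm v))) ^ 2
        + tensorFun ν z * ν l v
            * (f (update z 0 (ψ.symm v)) - f (edgeFlowSwap ψ 0 l (update z 0 (ψ.symm v)))) ^ 2
        + tensorFun ν z * ν l v
            * (f (edgeFlowSwap ψ 0 l (update z 0 (ψ.symm v)))
              - f (update (edgeFlowSwap ψ 0 l (update z 0 (ψ.symm v))) 0 (z 0))) ^ 2) := by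
    intro z v
    rw [update_eq_mapRotation z hl ψ v]
    have hw : 0 ≤ tensorFun ν z * ν l v := mul_nonneg (hW0 z) (hν _ _).le
    have h3 := mul_sq_add_add_le_three hw (f z - f (update z 0 (ψ.symm v)))
      (f (update z 0 (ψ.symm v)) - f (edgeFlowSwap ψ 0 l (update z 0 (ψ.symm v))))
      (f (edgeFlowSwap ψ 0 l (update z 0 (ψ.symm v)))
        - f (update (edgeFlowSwap ψ 0 l (update z 0 (ψ.symm v))) 0 (z 0)))
    have e : f z - f (update (edgeFlowSwap ψ 0 l (update z 0 (ψ.symm v))) 0 (z 0))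
        = (f z - f (update z 0 (ψ.symm v)))
          + (f (update z 0 (ψ.symm v)) - f (edgeFlowSwap ψ 0 l (update z 0 (ψ.symm v))))
          + (f (edgeFlowSwap ψ 0 l (update z 0 (ψ.symm v)))
            - f (update (edgeFlowSwap ψ 0 l (update z 0 (ψ.symm v))) 0 (z 0))) := by ring
    rw [e]
    nlinarith [h3]
  have hsum := sum_le_sum fun z (_ : z ∈ (univ : Finset (Fin (K + 1) → S))) =>
    sum_le_sum fun v (_ : v ∈ (univ : Finset S)) => hpt z v
  simp only [Finset.sum_add_distrib, ← Finset.mul_sum] at hsum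
  calc ∑ z : Fin (K + 1) → S, ∑ v, tensorFun ν z * ν l v * (f z - f (update z l v)) ^ 2
      ≤ 3 * (1 / p * (∑ z : Fin (K + 1) → S, ∑ v, tensorFun ν z * ν 0 v * (f z - f (update z 0 v)) ^ 2)
          + 1 / p * (∑ w : Fin (K + 1) → S, min (tensorFun ν w) (tensorFun ν (edgeFlowSwap ψ 0 l w))
              * (f w - f (edgeFlowSwap ψ 0 l w)) ^ 2)
          + 1 / p * (∑ z : Fin (K + 1) → S, ∑ v, tensorFun ν z * ν 0 v * (f z - f (update z 0 v)) ^ 2)) :=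
        le_trans hsum (by nlinarith [L1, L2, L3])
    _ = _ := by ring

end Legs

/-! ## §2 Hub lists with per-entry maps: the variance inequality -/

section HubList

variable {m : ℕ} (hν : ∀ k u, 0 < ν k u) (hν1 : ∀ k, ∑ u, ν k u = 1) {p : ℝ} (hp : 0 < p)
  (κ : Fin m → Fin K) (φ : Fin m → Equiv.Perm S) (hpers : ∀ (r : Fin m) (u : S), p * ν (κ r).succ (φ r u) ≤ ν 0 u)
include hν hν1 hp hpers

/-- **The cold-redraw energy of level `k+1` averaged over its entries:** if `(0, k+1)` is listed `c_k ≥ 1` times,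
`c_k·Σ_zΣ_v ν⊗(z)ν_{k+1}(v)(f z − f z^{k+1←v})² ≤ c_k·(6/p)·V₀ + (3/p)·Σ_{r : κ_r = k} T_r`. [ours] -/
theorem mapStar_coldRedraw_le_fiber (f : (Fin (K + 1) → S) → ℝ) (k : Fin K) :
    ((univ.filter (fun r : Fin m => κ r = k)).card : ℝ)
        * ∑ z : Fin (K + 1) → S, ∑ v, tensorFun ν z * ν k.succ v * (f z - f (update z k.succ v)) ^ 2
      ≤ ((univ.filter (fun r : Fin m => κ r = k)).card : ℝ)
          * (6 / p * ∑ z : Fin (K + 1) → S, ∑ v, tensorFun ν z * ν 0 v * (f z - f (update z 0 v)) ^ 2)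
        + 3 / p * ∑ r ∈ univ.filter (fun r : Fin m => κ r = k), ∑ w : Fin (K + 1) → S,
            min (tensorFun ν w) (tensorFun ν (edgeFlowSwap (φ r) 0 (κ r).succ w))
              * (f w - f (edgeFlowSwap (φ r) 0 (κ r).succ w)) ^ 2 := by
  set F := univ.filter (fun r : Fin m => κ r = k) with hF
  have hr : ∀ r ∈ F, ∑ z : Fin (K + 1) → S, ∑ v, tensorFun ν z * ν k.succ v * (f z - f (update z k.succ v)) ^ 2
      ≤ 6 / p * (∑ z : Fin (K + 1) → S, ∑ v, tensorFun ν z * ν 0 v * (f z - f (update z 0 v)) ^ 2)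
        + 3 / p * ∑ w : Fin (K + 1) → S, min (tensorFun ν w) (tensorFun ν (edgeFlowSwap (φ r) 0 (κ r).succ w))
            * (f w - f (edgeFlowSwap (φ r) 0 (κ r).succ w)) ^ 2 := by
    intro r hrF
    have hrk : κ r = k := (Finset.mem_filter.mp hrF).2
    have h := mapStar_coldRedraw_le hν hν1 hp (l := (κ r).succ) (Fin.succ_ne_zero _) (ψ := φ r) (hpers r) f
    rw [hrk] at h ⊢
    exact h
  have hs := Finset.sum_le_sum hr
  rw [sum_const, nsmul_eq_mul, sum_add_distrib, sum_const, nsmul_eq_mul, ← mul_sum] at hs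
  exact hs

/-- **THE ROTATION-PATH VARIANCE INEQUALITY THROUGH PER-ENTRY MAPS.**  Positive probability vectors `ν_k` on `S`, a hub list
`κ : Fin m → Fin K` with entry maps `φ : Fin m → Equiv.Perm S`, transported one-sided domination `p·ν_{κ_r+1}(φ_r u) ≤ ν_0(u)`
(`0 < p`), every cold level listed at least `c ≥ 1` times.  Then for every `f`,
**`Var_{ν⊗}(f) ≤ (1/2 + 3K/p)·V₀(f) + (3/(2pc))·Σ_r T_r(f)`**, `V₀(f) = Σ_zΣ_v ν⊗(z)ν_0(v)(f z − f z^{0←v})²`,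
`T_r(f) = Σ_z min{ν⊗(z), ν⊗(y_r z)}(f z − f(y_r z))²`, `y_r = edgeFlowSwap (φ r) 0 (κ_r+1)`. [ours] -/
theorem mapStar_variance_le [DecidableEq S] {c : ℕ} (hc1 : 1 ≤ c) (hc : ∀ k : Fin K, c ≤ (univ.filter (fun r : Fin m => κ r = k)).card)
    (f : (Fin (K + 1) → S) → ℝ) :
    lawVariance (tensorFun ν) f
      ≤ (1 / 2 + 3 * K / p) * ∑ z : Fin (K + 1) → S, ∑ v, tensorFun ν z * ν 0 v * (f z - f (update z 0 v)) ^ 2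
        + 3 / (2 * p * c) * ∑ r : Fin m, ∑ w : Fin (K + 1) → S,
            min (tensorFun ν w) (tensorFun ν (edgeFlowSwap (φ r) 0 (κ r).succ w))
              * (f w - f (edgeFlowSwap (φ r) 0 (κ r).succ w)) ^ 2 := by
  have hW0 : ∀ z, 0 ≤ tensorFun ν z := fun z => (tensorFun_pos hν z).le
  set V₀ : ℝ := ∑ z : Fin (K + 1) → S, ∑ v, tensorFun ν z * ν 0 v * (f z - f (update z 0 v)) ^ 2 with hV₀
  set T : Fin m → ℝ := fun r => ∑ w : Fin (K + 1) → S,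
    min (tensorFun ν w) (tensorFun ν (edgeFlowSwap (φ r) 0 (κ r).succ w))
      * (f w - f (edgeFlowSwap (φ r) 0 (κ r).succ w)) ^ 2 with hT
  set E : Fin K → ℝ := fun k => ∑ z : Fin (K + 1) → S, ∑ v,
    tensorFun ν z * ν k.succ v * (f z - f (update z k.succ v)) ^ 2 with hE
  have hT0 : ∀ r, 0 ≤ T r := fun r => sum_nonneg fun w _ =>
    mul_nonneg (le_min (hW0 w) (hW0 _)) (sq_nonneg _)
  have hV0 : 0 ≤ V₀ := sum_nonneg fun z _ => sum_nonneg fun v _ => mul_nonneg (mul_nonneg (hW0 z) (hν _ _).le) (sq_nonneg _)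
  have hcpos : (0 : ℝ) < c := Nat.cast_pos.mpr (by omega)
  -- each cold level through its own entries
  have hEk : ∀ k : Fin K, E k ≤ 6 / p * V₀ + 3 / (p * c) * ∑ r ∈ univ.filter (fun r : Fin m => κ r = k), T r := by
    intro k
    set ck : ℝ := ((univ.filter (fun r : Fin m => κ r = k)).card : ℝ) with hck
    have hck1 : (c : ℝ) ≤ ck := by rw [hck]; exact_mod_cast hc k
    have hckpos : 0 < ck := lt_of_lt_of_le hcpos hck1
    have hfib := mapStar_coldRedraw_le_fiber hν hν1 hp κ φ hpers f k
    have hFk0 : 0 ≤ ∑ r ∈ univ.filter (fun r : Fin m => κ r = k), T r := sum_nonneg fun r _ => hT0 r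
    have h1 : ck * E k ≤ ck * (6 / p * V₀) + 3 / p * ∑ r ∈ univ.filter (fun r : Fin m => κ r = k), T r := hfib
    have h2 : E k ≤ 6 / p * V₀ + (3 / p * ∑ r ∈ univ.filter (fun r : Fin m => κ r = k), T r) / ck := by
      have h3 : E k - 6 / p * V₀ ≤ (3 / p * ∑ r ∈ univ.filter (fun r : Fin m => κ r = k), T r) / ck := by
        rw [le_div_iff₀ hckpos]
        nlinarith [h1]
      linarith
    have h4 : (3 / p * ∑ r ∈ univ.filter (fun r : Fin m => κ r = k), T r) / ck
        ≤ (3 / p * ∑ r ∈ univ.filter (fun r : Fin m => κ r = k), T r) / c :=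
      div_le_div_of_nonneg_left (by positivity) hcpos hck1
    calc E k ≤ 6 / p * V₀ + (3 / p * ∑ r ∈ univ.filter (fun r : Fin m => κ r = k), T r) / ck := h2
      _ ≤ 6 / p * V₀ + (3 / p * ∑ r ∈ univ.filter (fun r : Fin m => κ r = k), T r) / c := by linarith
      _ = 6 / p * V₀ + 3 / (p * c) * ∑ r ∈ univ.filter (fun r : Fin m => κ r = k), T r := by
          field_simp
  -- summing over the cold levels: the fibres of `κ` partition the entries
  have hfiber : ∑ k : Fin K, ∑ r ∈ univ.filter (fun r : Fin m => κ r = k), T r = ∑ r : Fin m, T r :=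
    Finset.sum_fiberwise univ κ T
  have hcold : ∑ k : Fin K, E k ≤ 6 * K / p * V₀ + 3 / (p * c) * ∑ r : Fin m, T r := by
    calc ∑ k : Fin K, E k ≤ ∑ k : Fin K, (6 / p * V₀ + 3 / (p * c) * ∑ r ∈ univ.filter (fun r : Fin m => κ r = k), T r) :=
          sum_le_sum fun k _ => hEk k
      _ = 6 * K / p * V₀ + 3 / (p * c) * ∑ r : Fin m, T r := by
          rw [sum_add_distrib, sum_const, card_univ, Fintype.card_fin, nsmul_eq_mul, ← mul_sum, hfiber]
          ring
  -- Efron–Stein over the `K+1` coordinates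
  have ES := efronStein_tensorFun (ν := ν) (fun k u => (hν k u).le) hν1 f
  rw [Fin.sum_univ_succ] at ES
  have hES : lawVariance (tensorFun ν) f ≤ 1 / 2 * V₀ + 1 / 2 * ∑ k : Fin K, E k := by
    have e : ∑ k : Fin K, (1 / 2) * ∑ z : Fin (K + 1) → S, ∑ v,
        tensorFun ν z * ν k.succ v * (f z - f (update z k.succ v)) ^ 2 = 1 / 2 * ∑ k : Fin K, E k := by
      rw [mul_sum]
    rw [e] at ES
    exact ES
  calc lawVariance (tensorFun ν) f ≤ 1 / 2 * V₀ + 1 / 2 * ∑ k : Fin K, E k := hES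
    _ ≤ 1 / 2 * V₀ + 1 / 2 * (6 * K / p * V₀ + 3 / (p * c) * ∑ r : Fin m, T r) := by linarith [hcold]
    _ = (1 / 2 + 3 * K / p) * V₀ + 3 / (2 * p * c) * ∑ r : Fin m, T r := by
        field_simp
        ring

end HubList

end Summit.Ventures.LatticeQCDFlow.Scaling

end
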